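/-
COR-CM (cell pub-hodgecm2, stage 2 of the Hodge ladder) — count-neutral KERNEL SYMMETRY of the face-form period theorem, sequel of
`CorCM/FacePeriodDuality.lean` (the dual face): the remaining symmetries of the TYPE SQUARE of a rank-four face — `PeriodNV` depends
only on the square.  Seat prover-pub-hodgecm2-b07-g32-0 (binder prover b07, gen 32; claim FACE-SQUARE, HOME/lit/LIT-STATUS.md
2026-08-21T09:01Z).  Two support definitions (`Face.swap`, `Face.antipode`), theorems; no named fact, nothing asserted; nothing under
`CorCM/B01/` is edited; `Interfaces.lean` (C1) untouched.
-/
import Summits.HodgeConjecture.CorCM.FacePeriodDuality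
import HarnessLib

/-!
# The period statement of a face depends only on its type square

A rank-four face `f = (Φ; π, π′)` (rfwf Def. 1.1) determines the SQUARE `{Φ, Φ^{(π)}, Φ^{(π′)}, Φ^{(ππ′)}}` of CM types (flips at the two
places) with its partition into diagonals `{Φ, Φ^{(ππ′)}} | {Φ^{(π)}, Φ^{(π′)}}`; conversely a square carries eight faces (base corner ×
order of the two places — the dihedral group of the square), and the period types of each are a permutation of `(Φ, Φ^{(ππ′)}, Φ^{(π)},
Φ^{(π′)})` respecting the partition.  `CorCM/FacePeriodDuality.lean` treats the one symmetry that EXCHANGES the diagonals (`Face.dual`,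
period ↦ conjugate period).  This file adds the two that preserve them:

1. `Face.swap f := (Φ; π′, π)` — `swap.psi = psi ∘ ![0, 1, 3, 2]` (`flip_comm`: flips at different places commute); the period changes
   sign (`Universe.period_swap23`, `Fact_cup_comm1`).
2. `Face.antipode f := (Φ^{(ππ′)}; π, π′)` — `antipode.psi = psi ∘ ![1, 0, 3, 2]`; the period is unchanged (`Universe.period_swap01_swap23`).
3. Representatives do not matter: `flip_eq_of_mk_eq` (a flip depends on the place only), `Face.psi_eq_of_mk_eq`.
4. **`Universe.periodNV_iff_of_sameSquare`** (any universe with `Fact_cup_comm1`, `Fact_cup_interchange`; `Model.periodNV_iff_of_sameSquare`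
   on the universe of record): if `f'` has the same unordered pair of places as `f` and its base type is one of the four corners of the
   square of `f`, then `U.PeriodNV ι₁ V F f'.psi σ ↔ U.PeriodNV ι₁ V F f.psi σ`; likewise admissibility (`Face.admissible_iff_of_sameSquare`).
   So `PeriodThmF` is ONE statement per square: for `[F:ℚ] = 2g` there are `C(g,2) · 2^{g-2}` squares, and `ι₁` is admissible for all
   eight faces of a square or for none.

References: rfwf v3 Def. 1.1 / §4.2; PerL v5 §1 (the four types `t¹ = (+,+,+)`, `t² = (+,−,−)`, `t³ = (+,−,+)`, `t⁴ = (+,+,−)` of the sextic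
field form the square of `t¹` under the flips at the places 2, 3, read as the face `(t¹; φ₂, φ₃)`); A. Hatcher, *Algebraic Topology* (2002)
§3.2 Thm. 3.11.
-/

noncomputable section

open scoped TensorProduct
open NumberField
open Literature.AlgebraicGeometry.Motives (CMType HodgeStructure)
open Literature.AlgebraicGeometry.Motives.HodgeStructure (conj)
open Literature.NumberTheory.ComplexMultiplication.CMTypeOps
open Literature.AlgebraicGeometry.HodgeTheory
open Literature.NumberTheory.Automorphic.PicardCM

namespace Summit.HodgeConjecture.CorCM

/-! ## §1  Flips commute and depend on the place only -/

/-- Flips at two places commute: `(Φ^{(p)})^{(q)} = (Φ^{(q)})^{(p)}` (symmetric differences commute). -/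
theorem flip_comm {K : Type} [Field K] (p q : K →+* ℂ) (Φ : CMType K) : flip p (flip q Φ) = flip q (flip p Φ) := by
  apply Subtype.ext
  show symmDiff (symmDiff Φ.1 (placeSet q)) (placeSet p) = symmDiff (symmDiff Φ.1 (placeSet p)) (placeSet q)
  exact symmDiff_right_comm _ _ _

/-- The orbit `{p, p̄}` depends only on the place of `p`. -/
theorem placeSet_eq_of_mk_eq {K : Type} [Field K] {p q : K →+* ℂ} (h : InfinitePlace.mk p = InfinitePlace.mk q) :
    placeSet p = placeSet q := by
  rcases InfinitePlace.mk_eq_iff.1 h with rfl | rfl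
  · rfl
  · ext φ
    simp only [placeSet, Set.mem_insert_iff, Set.mem_singleton_iff, ComplexEmbedding.involutive_conjugate K p]
    tauto

/-- **A flip depends on the place only**: `Φ^{(p)} = Φ^{(q)}` when `p`, `q` lie over the same infinite place. -/
theorem flip_eq_of_mk_eq {K : Type} [Field K] {p q : K →+* ℂ} (h : InfinitePlace.mk p = InfinitePlace.mk q) (Φ : CMType K) :
    flip p Φ = flip q Φ := by
  apply Subtype.ext
  show symmDiff Φ.1 (placeSet p) = symmDiff Φ.1 (placeSet q)
  rw [placeSet_eq_of_mk_eq h]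

namespace Face

variable {K : Type} [Field K]

/-- **The period types depend on the places only**: faces with the same base type and representatives over the same two places
(in the same order) have the same period types. -/
theorem psi_eq_of_mk_eq {f f' : Face K} (hΦ : f'.Φ = f.Φ) (hp : InfinitePlace.mk f'.p = InfinitePlace.mk f.p)
    (hp' : InfinitePlace.mk f'.p' = InfinitePlace.mk f.p') : f'.psi = f.psi := by
  funext i
  match i with
  | 0 => exact hΦ
  | 1 =>
    show flip f'.p' (flip f'.p f'.Φ) = flip f.p' (flip f.p f.Φ)
    rw [hΦ, flip_eq_of_mk_eq hp, flip_eq_of_mk_eq hp']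
  | 2 =>
    show flip f'.p f'.Φ = flip f.p f.Φ
    rw [hΦ, flip_eq_of_mk_eq hp]
  | 3 =>
    show flip f'.p' f'.Φ = flip f.p' f.Φ
    rw [hΦ, flip_eq_of_mk_eq hp']

/-- Admissibility depends on the places only. -/
theorem admissible_iff_of_mk_eq {f f' : Face K} (hΦ : f'.Φ = f.Φ) (hp : InfinitePlace.mk f'.p = InfinitePlace.mk f.p)
    (hp' : InfinitePlace.mk f'.p' = InfinitePlace.mk f.p') (ι₁ : K →+* ℂ) : f'.Admissible ι₁ ↔ f.Admissible ι₁ := by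
  simp only [Face.Admissible, hΦ, hp, hp']

/-! ## §2  Swapping the two places -/

/-- **The swapped face** `(Φ; π′, π)`: same square, same diagonals, the conjugated pair reordered. -/
def swap (f : Face K) : Face K where
  Φ := f.Φ
  p := f.p'
  p' := f.p
  place_ne := f.place_ne.symm

/-- The swapped face has the same base type. -/
@[simp] theorem swap_Φ (f : Face K) : f.swap.Φ = f.Φ := rfl

/-- The first place of the swapped face is the second place of the face. -/
@[simp] theorem swap_p (f : Face K) : f.swap.p = f.p' := rfl

/-- The second place of the swapped face is the first place of the face. -/
@[simp] theorem swap_p' (f : Face K) : f.swap.p' = f.p := rfl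

/-- Swapping twice gives the face back. -/
theorem swap_swap (f : Face K) : f.swap.swap = f := by
  cases f; rfl

/-- **The period types of the swapped face**: `(ψ₀, ψ₁, ψ₃, ψ₂)` — the (34)-pair reordered (`flip_comm` in slot 1). -/
theorem swap_psi_eq_comp (f : Face K) : f.swap.psi = f.psi ∘ ![0, 1, 3, 2] := by
  funext i
  fin_cases i
  · rfl
  · exact flip_comm f.p f.p' f.Φ
  · rfl
  · rfl

/-- Admissibility is unchanged by swapping the places. -/
theorem swap_admissible_iff (f : Face K) (ι₁ : K →+* ℂ) : f.swap.Admissible ι₁ ↔ f.Admissible ι₁ := by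
  simp only [Face.Admissible, swap_Φ, swap_p, swap_p']
  tauto

/-! ## §3  Moving the base corner to the opposite corner -/

/-- **The antipodal face** `(Φ^{(ππ′)}; π, π′)`: base corner moved along the diagonal; same square, same diagonals, both pairs
reordered. -/
def antipode (f : Face K) : Face K where
  Φ := flip f.p' (flip f.p f.Φ)
  p := f.p
  p' := f.p'
  place_ne := f.place_ne

/-- The base type of the antipodal face is `Φ^{(ππ′)} = ψ₁`. -/
@[simp] theorem antipode_Φ (f : Face K) : f.antipode.Φ = flip f.p' (flip f.p f.Φ) := rfl

/-- The antipodal face has the same first place. -/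
@[simp] theorem antipode_p (f : Face K) : f.antipode.p = f.p := rfl

/-- The antipodal face has the same second place. -/
@[simp] theorem antipode_p' (f : Face K) : f.antipode.p' = f.p' := rfl

/-- **The period types of the antipodal face**: `(ψ₁, ψ₀, ψ₃, ψ₂)` — both pairs reordered. -/
theorem antipode_psi_eq_comp (f : Face K) : f.antipode.psi = f.psi ∘ ![1, 0, 3, 2] := by
  funext i
  fin_cases i
  · rfl
  · show flip f.p' (flip f.p (flip f.p' (flip f.p f.Φ))) = f.Φ
    rw [flip_comm f.p f.p' (flip f.p f.Φ), Literature.NumberTheory.ComplexMultiplication.CMTypeOps.flip_flip,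
      Literature.NumberTheory.ComplexMultiplication.CMTypeOps.flip_flip]
  · show flip f.p (flip f.p' (flip f.p f.Φ)) = flip f.p' f.Φ
    rw [flip_comm f.p f.p' (flip f.p f.Φ), Literature.NumberTheory.ComplexMultiplication.CMTypeOps.flip_flip]
  · show flip f.p' (flip f.p' (flip f.p f.Φ)) = flip f.p f.Φ
    rw [Literature.NumberTheory.ComplexMultiplication.CMTypeOps.flip_flip]

/-- The antipode is an involution. -/
theorem antipode_antipode (f : Face K) : f.antipode.antipode = f := by
  cases f with
  | mk Φ p p' h =>
    simp only [antipode, Face.mk.injEq, and_true]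
    rw [flip_comm p p' (flip p Φ), Literature.NumberTheory.ComplexMultiplication.CMTypeOps.flip_flip,
      Literature.NumberTheory.ComplexMultiplication.CMTypeOps.flip_flip]

/-- Admissibility is unchanged by moving to the antipodal corner (`ι₁` lies over neither flipped place). -/
theorem antipode_admissible_iff (f : Face K) (ι₁ : K →+* ℂ) : f.antipode.Admissible ι₁ ↔ f.Admissible ι₁ := by
  simp only [Face.Admissible, antipode_p, antipode_p', antipode_Φ]
  constructor
  · rintro ⟨h0, h1, h2⟩
    refine ⟨?_, h1, h2⟩
    have hx : ι₁ ∉ placeSet f.p := fun hx => h1 (mk_eq_of_mem_placeSet hx)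
    have hy : ι₁ ∉ placeSet f.p' := fun hy => h2 (mk_eq_of_mem_placeSet hy)
    exact (mem_flip_iff_of_not_mem_placeSet hx f.Φ).1 ((mem_flip_iff_of_not_mem_placeSet hy _).1 h0)
  · rintro ⟨h0, h1, h2⟩
    refine ⟨?_, h1, h2⟩
    have hx : ι₁ ∉ placeSet f.p := fun hx => h1 (mk_eq_of_mem_placeSet hx)
    have hy : ι₁ ∉ placeSet f.p' := fun hy => h2 (mk_eq_of_mem_placeSet hy)
    exact (mem_flip_iff_of_not_mem_placeSet hy _).2 ((mem_flip_iff_of_not_mem_placeSet hx f.Φ).2 h0)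

/-- The dual of the swapped face, swapped back, is the face with base corner `Φ^{(π′)}`: the fourth corner of the square. -/
theorem swap_dual_swap_Φ (f : Face K) : f.swap.dual.swap.Φ = flip f.p' f.Φ := rfl

end Face

/-! ## §4  Period signs under reordering within the pairs -/

namespace Universe

variable {U : Universe}

/-- Reordering the conjugated pair changes the sign of the period: `∫ ω₀ ∧ ω₁ ∧ \overline{ω₃ ∧ ω₂} = −∫ ω₀ ∧ ω₁ ∧ \overline{ω₂ ∧ ω₃}`
(`Fact_cup_comm1`). -/
theorem period_swap23 (h1 : U.Fact_cup_comm1) (X : U.Var) (ω : Fin 4 → U.CohC X 1) :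
    U.period X ![ω 0, ω 1, ω 3, ω 2] = -U.period X ω := by
  simp only [Universe.period, Matrix.cons_val_zero, Matrix.cons_val_one, Matrix.cons_val]
  rw [quadC_swap23 h1 X (ω 0) (ω 1) (conj (ω 2)) (conj (ω 3)), map_neg, neg_neg]

/-- Reordering both pairs leaves the period unchanged: `∫ ω₁ ∧ ω₀ ∧ \overline{ω₃ ∧ ω₂} = ∫ ω₀ ∧ ω₁ ∧ \overline{ω₂ ∧ ω₃}`. -/
theorem period_swap01_swap23 (h1 : U.Fact_cup_comm1) (X : U.Var) (ω : Fin 4 → U.CohC X 1) :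
    U.period X ![ω 1, ω 0, ω 3, ω 2] = U.period X ω := by
  simp only [Universe.period, Matrix.cons_val_zero, Matrix.cons_val_one, Matrix.cons_val]
  rw [quadC_swap01 h1 X (ω 1) (ω 0), quadC_swap23 h1 X (ω 0) (ω 1) (conj (ω 3)) (conj (ω 2)), neg_neg]

/-- `PeriodNV` along a reindexing `e` of the four types that fixes the period up to sign: from `Ψ` to `Ψ ∘ e`. -/
private theorem periodNV_comp_of_period {L : CMField} {ι₁ : L →+* ℂ} {V : HermSpace3 L ι₁} (K : CMField)
    (Ψ : Fin 4 → CMType K) (σ : K →+* ℂ) (e : Fin 4 → Fin 4)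
    (he : ∀ (X : U.Var) (ω : Fin 4 → U.CohC X 1), U.period X ω ≠ 0 → U.period X (ω ∘ e) ≠ 0)
    (h : U.PeriodNV ι₁ V K Ψ σ) : U.PeriodNV ι₁ V K (Ψ ∘ e) σ := by
  obtain ⟨Γ, F, α, hα, hper⟩ := h
  exact ⟨Γ, fun i => F (e i), fun i => α (e i), fun i => hα _, he _ (fun i => U.pullC (F i) 1 (α i)) hper⟩

/-- `PeriodNV` is invariant under reordering the conjugated pair of types. -/
theorem periodNV_comp_swap23_iff (h1 : U.Fact_cup_comm1) {L : CMField} {ι₁ : L →+* ℂ} {V : HermSpace3 L ι₁} (K : CMField)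
    (Ψ : Fin 4 → CMType K) (σ : K →+* ℂ) :
    U.PeriodNV ι₁ V K (Ψ ∘ ![0, 1, 3, 2]) σ ↔ U.PeriodNV ι₁ V K Ψ σ := by
  have he : ∀ (X : U.Var) (ω : Fin 4 → U.CohC X 1), U.period X ω ≠ 0 →
      U.period X (ω ∘ (![0, 1, 3, 2] : Fin 4 → Fin 4)) ≠ 0 := by
    intro X ω hω
    have hfun : ω ∘ (![0, 1, 3, 2] : Fin 4 → Fin 4) = ![ω 0, ω 1, ω 3, ω 2] := by
      funext i; fin_cases i <;> rfl
    rw [hfun, period_swap23 h1]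
    exact neg_ne_zero.2 hω
  refine ⟨fun h => ?_, periodNV_comp_of_period K Ψ σ _ he⟩
  have h' := periodNV_comp_of_period K (Ψ ∘ ![0, 1, 3, 2]) σ _ he h
  have hid : ((![0, 1, 3, 2] : Fin 4 → Fin 4) ∘ (![0, 1, 3, 2] : Fin 4 → Fin 4)) = id := by
    funext i; fin_cases i <;> rfl
  rwa [Function.comp_assoc, hid, Function.comp_id] at h'

/-- `PeriodNV` is invariant under reordering both pairs of types. -/
theorem periodNV_comp_swap01_swap23_iff (h1 : U.Fact_cup_comm1) {L : CMField} {ι₁ : L →+* ℂ} {V : HermSpace3 L ι₁}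
    (K : CMField) (Ψ : Fin 4 → CMType K) (σ : K →+* ℂ) :
    U.PeriodNV ι₁ V K (Ψ ∘ ![1, 0, 3, 2]) σ ↔ U.PeriodNV ι₁ V K Ψ σ := by
  have he : ∀ (X : U.Var) (ω : Fin 4 → U.CohC X 1), U.period X ω ≠ 0 →
      U.period X (ω ∘ (![1, 0, 3, 2] : Fin 4 → Fin 4)) ≠ 0 := by
    intro X ω hω
    have hfun : ω ∘ (![1, 0, 3, 2] : Fin 4 → Fin 4) = ![ω 1, ω 0, ω 3, ω 2] := by
      funext i; fin_cases i <;> rfl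
    rwa [hfun, period_swap01_swap23 h1]
  refine ⟨fun h => ?_, periodNV_comp_of_period K Ψ σ _ he⟩
  have h' := periodNV_comp_of_period K (Ψ ∘ ![1, 0, 3, 2]) σ _ he h
  have hid : ((![1, 0, 3, 2] : Fin 4 → Fin 4) ∘ (![1, 0, 3, 2] : Fin 4 → Fin 4)) = id := by
    funext i; fin_cases i <;> rfl
  rwa [Function.comp_assoc, hid, Function.comp_id] at h'

/-- **`PeriodNV` is unchanged by swapping the two places of the face.** -/
theorem periodNV_face_swap_iff (h1 : U.Fact_cup_comm1) {F : CMField} (f : Face F) {ι₁ : F →+* ℂ} (V : HermSpace3 F ι₁)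
    (σ : F →+* ℂ) : U.PeriodNV ι₁ V F f.swap.psi σ ↔ U.PeriodNV ι₁ V F f.psi σ := by
  rw [Face.swap_psi_eq_comp]
  exact periodNV_comp_swap23_iff h1 F f.psi σ

/-- **`PeriodNV` is unchanged by moving the base corner to the antipodal corner.** -/
theorem periodNV_face_antipode_iff (h1 : U.Fact_cup_comm1) {F : CMField} (f : Face F) {ι₁ : F →+* ℂ} (V : HermSpace3 F ι₁)
    (σ : F →+* ℂ) : U.PeriodNV ι₁ V F f.antipode.psi σ ↔ U.PeriodNV ι₁ V F f.psi σ := by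
  rw [Face.antipode_psi_eq_comp]
  exact periodNV_comp_swap01_swap23_iff h1 F f.psi σ

/-! ## §5  `PeriodNV` depends only on the square -/

/-- **`PeriodNV` depends only on the type square of the face** (any universe with `Fact_cup_comm1`, `Fact_cup_interchange`).  If `f'`
has the same unordered pair of places as `f` and its base type is one of the four corners `Φ, Φ^{(π)}, Φ^{(π′)}, Φ^{(ππ′)}` of the
square of `f`, then the period statements for `f'` and `f` are equivalent: `f'` has the period types of one of the eight faces
`f, f^∨, …` of the square (`Face.psi_eq_of_mk_eq`), each reached from `f` by `dual` (conjugate period), `swap` (sign) and `antipode`. -/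
theorem periodNV_iff_of_sameSquare (h1 : U.Fact_cup_comm1) (h2 : U.Fact_cup_interchange) {F : CMField} {f f' : Face F}
    (hpl : (InfinitePlace.mk f'.p = InfinitePlace.mk f.p ∧ InfinitePlace.mk f'.p' = InfinitePlace.mk f.p') ∨
      (InfinitePlace.mk f'.p = InfinitePlace.mk f.p' ∧ InfinitePlace.mk f'.p' = InfinitePlace.mk f.p))
    (hΦ : f'.Φ = f.Φ ∨ f'.Φ = flip f.p f.Φ ∨ f'.Φ = flip f.p' f.Φ ∨ f'.Φ = flip f.p' (flip f.p f.Φ))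
    {ι₁ : F →+* ℂ} (V : HermSpace3 F ι₁) (σ : F →+* ℂ) :
    U.PeriodNV ι₁ V F f'.psi σ ↔ U.PeriodNV ι₁ V F f.psi σ := by
  rcases hpl with ⟨hp, hp'⟩ | ⟨hp, hp'⟩
  · -- same order of places: `f'` has the period types of `f`, `f.dual`, `f.swap.dual.swap` or `f.antipode`
    rcases hΦ with hΦ | hΦ | hΦ | hΦ
    · rw [Face.psi_eq_of_mk_eq (f := f) hΦ hp hp']
    · rw [Face.psi_eq_of_mk_eq (f := f.dual) hΦ hp hp']
      exact periodNV_face_dual_iff h1 h2 f V σ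
    · rw [Face.psi_eq_of_mk_eq (f := f.swap.dual.swap) hΦ hp hp', periodNV_face_swap_iff h1,
        periodNV_face_dual_iff h1 h2, periodNV_face_swap_iff h1]
    · rw [Face.psi_eq_of_mk_eq (f := f.antipode) hΦ hp hp']
      exact periodNV_face_antipode_iff h1 f V σ
  · -- opposite order of places: the same four, swapped
    rcases hΦ with hΦ | hΦ | hΦ | hΦ
    · rw [Face.psi_eq_of_mk_eq (f := f.swap) hΦ hp hp']
      exact periodNV_face_swap_iff h1 f V σ
    · rw [Face.psi_eq_of_mk_eq (f := f.dual.swap) hΦ hp hp', periodNV_face_swap_iff h1]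
      exact periodNV_face_dual_iff h1 h2 f V σ
    · rw [Face.psi_eq_of_mk_eq (f := f.swap.dual) hΦ hp hp', periodNV_face_dual_iff h1 h2, periodNV_face_swap_iff h1]
    · have hΦ' : f'.Φ = f.antipode.swap.Φ := by
        rw [hΦ]; rfl
      rw [Face.psi_eq_of_mk_eq (f := f.antipode.swap) hΦ' hp hp', periodNV_face_swap_iff h1]
      exact periodNV_face_antipode_iff h1 f V σ

/-- **Admissibility depends only on the square** (same hypotheses): `ι₁` is admissible for `f'` iff for `f`. -/
theorem _root_.Summit.HodgeConjecture.CorCM.Face.admissible_iff_of_sameSquare {F : Type} [Field F] {f f' : Face F}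
    (hpl : (InfinitePlace.mk f'.p = InfinitePlace.mk f.p ∧ InfinitePlace.mk f'.p' = InfinitePlace.mk f.p') ∨
      (InfinitePlace.mk f'.p = InfinitePlace.mk f.p' ∧ InfinitePlace.mk f'.p' = InfinitePlace.mk f.p))
    (hΦ : f'.Φ = f.Φ ∨ f'.Φ = flip f.p f.Φ ∨ f'.Φ = flip f.p' f.Φ ∨ f'.Φ = flip f.p' (flip f.p f.Φ)) (ι₁ : F →+* ℂ) :
    f'.Admissible ι₁ ↔ f.Admissible ι₁ := by
  -- admissibility reads `ι₁ ∈ f'.Φ` and the two places; off those places every corner of the square contains `ι₁` iff `Φ` does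
  have key : ∀ {q q' : F →+* ℂ}, InfinitePlace.mk ι₁ ≠ InfinitePlace.mk f.p → InfinitePlace.mk ι₁ ≠ InfinitePlace.mk f.p' →
      (ι₁ ∈ f'.Φ.1 ↔ ι₁ ∈ f.Φ.1) := by
    intro _ _ h1 h2
    have hx : ι₁ ∉ placeSet f.p := fun hx => h1 (mk_eq_of_mem_placeSet hx)
    have hy : ι₁ ∉ placeSet f.p' := fun hy => h2 (mk_eq_of_mem_placeSet hy)
    rcases hΦ with hΦ | hΦ | hΦ | hΦ <;> rw [hΦ]
    · rw [mem_flip_iff_of_not_mem_placeSet hx]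
    · rw [mem_flip_iff_of_not_mem_placeSet hy]
    · rw [mem_flip_iff_of_not_mem_placeSet hy, mem_flip_iff_of_not_mem_placeSet hx]
  simp only [Face.Admissible]
  rcases hpl with ⟨hp, hp'⟩ | ⟨hp, hp'⟩ <;> rw [hp, hp']
  · constructor
    · rintro ⟨h0, h1, h2⟩; exact ⟨(key (q := f.p) (q' := f.p') h1 h2).1 h0, h1, h2⟩
    · rintro ⟨h0, h1, h2⟩; exact ⟨(key (q := f.p) (q' := f.p') h1 h2).2 h0, h1, h2⟩
  · constructor
    · rintro ⟨h0, h1, h2⟩; exact ⟨(key (q := f.p) (q' := f.p') h2 h1).1 h0, h2, h1⟩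
    · rintro ⟨h0, h1, h2⟩; exact ⟨(key (q := f.p) (q' := f.p') h1 h2).2 h0, h2, h1⟩

/-- **`PeriodThmF` per square.**  If the period theorem holds at ONE face of each square (a family `R` of representatives: every face
shares its square with some selected face), it holds at all faces. -/
theorem periodThmF_of_squareRepresentatives (h1 : U.Fact_cup_comm1) (h2 : U.Fact_cup_interchange)
    (R : ∀ ⦃F : CMField⦄, Face F → Prop)
    (hR : ∀ ⦃F : CMField⦄ (f' : Face F), ∃ f : Face F, R f ∧
      ((InfinitePlace.mk f'.p = InfinitePlace.mk f.p ∧ InfinitePlace.mk f'.p' = InfinitePlace.mk f.p') ∨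
        (InfinitePlace.mk f'.p = InfinitePlace.mk f.p' ∧ InfinitePlace.mk f'.p' = InfinitePlace.mk f.p)) ∧
      (f'.Φ = f.Φ ∨ f'.Φ = flip f.p f.Φ ∨ f'.Φ = flip f.p' f.Φ ∨ f'.Φ = flip f.p' (flip f.p f.Φ)))
    (h : ∀ (F : CMField), IsGalois ℚ F → 6 ≤ Module.finrank ℚ F → ∀ (f : Face F), R f →
      ∀ (ι₁ : F →+* ℂ), f.Admissible ι₁ → ∀ V : HermSpace3 F ι₁, U.PeriodNV ι₁ V F f.psi ι₁) :
    U.PeriodThmF := by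
  intro F hG h6 f' ι₁ hι V
  obtain ⟨f, hRf, hpl, hΦ⟩ := hR f'
  exact (periodNV_iff_of_sameSquare h1 h2 hpl hΦ V ι₁).2
    (h F hG h6 f hRf ι₁ ((Face.admissible_iff_of_sameSquare hpl hΦ ι₁).1 hι) V)

end Universe

/-! ## §6  The universe of record -/

namespace Model

/-- **`PeriodNV` depends only on the square** on the universe of record `picardCMUniverse hHD hI h₁ h₃` (rows M19/M20 of
`picardCMUniverse_modelAxioms`). -/
theorem periodNV_iff_of_sameSquare (hHD : exists_isReal_hodgeModel) (hI : hodgePQ_independent_of_hodgeModel)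
    (h₁ : BallQuotientUniformised) (h₃ : CMAbelianVarietyRealised) {F : CMField} {f f' : Face F}
    (hpl : (InfinitePlace.mk f'.p = InfinitePlace.mk f.p ∧ InfinitePlace.mk f'.p' = InfinitePlace.mk f.p') ∨
      (InfinitePlace.mk f'.p = InfinitePlace.mk f.p' ∧ InfinitePlace.mk f'.p' = InfinitePlace.mk f.p))
    (hΦ : f'.Φ = f.Φ ∨ f'.Φ = flip f.p f.Φ ∨ f'.Φ = flip f.p' f.Φ ∨ f'.Φ = flip f.p' (flip f.p f.Φ))
    {ι₁ : F →+* ℂ} (V : HermSpace3 F ι₁) (σ : F →+* ℂ) :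
    (picardCMUniverse hHD hI h₁ h₃).PeriodNV ι₁ V F f'.psi σ ↔ (picardCMUniverse hHD hI h₁ h₃).PeriodNV ι₁ V F f.psi σ :=
  Universe.periodNV_iff_of_sameSquare (picardCMUniverse_modelAxioms hHD hI h₁ h₃).cup_comm1
    (picardCMUniverse_modelAxioms hHD hI h₁ h₃).cup_interchange hpl hΦ V σ

/-- **`PerLFace` of the universe of record from one face per square.** -/
theorem perLFace_of_squareRepresentatives (hHD : exists_isReal_hodgeModel) (hI : hodgePQ_independent_of_hodgeModel)
    (h₁ : BallQuotientUniformised) (h₃ : CMAbelianVarietyRealised) (R : ∀ ⦃F : CMField⦄, Face F → Prop)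
    (hR : ∀ ⦃F : CMField⦄ (f' : Face F), ∃ f : Face F, R f ∧
      ((InfinitePlace.mk f'.p = InfinitePlace.mk f.p ∧ InfinitePlace.mk f'.p' = InfinitePlace.mk f.p') ∨
        (InfinitePlace.mk f'.p = InfinitePlace.mk f.p' ∧ InfinitePlace.mk f'.p' = InfinitePlace.mk f.p)) ∧
      (f'.Φ = f.Φ ∨ f'.Φ = flip f.p f.Φ ∨ f'.Φ = flip f.p' f.Φ ∨ f'.Φ = flip f.p' (flip f.p f.Φ)))
    (h : ∀ (F : CMField), IsGalois ℚ F → 6 ≤ Module.finrank ℚ F → ∀ (f : Face F), R f →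
      ∀ (ι₁ : F →+* ℂ), f.Admissible ι₁ → ∀ V : HermSpace3 F ι₁, (picardCMUniverse hHD hI h₁ h₃).PeriodNV ι₁ V F f.psi ι₁) :
    (picardCMUniverse hHD hI h₁ h₃).PerLFace :=
  Universe.periodThmF_of_squareRepresentatives (picardCMUniverse_modelAxioms hHD hI h₁ h₃).cup_comm1
    (picardCMUniverse_modelAxioms hHD hI h₁ h₃).cup_interchange R hR h

end Model

end Summit.HodgeConjecture.CorCM

end
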